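import Literature.Probability.LatticeModels.SixVertexTransferMatrix
import Literature.Probability.LatticeModels.SixVertexGFFInvariance
import Literature.LinearAlgebra.Matrix.NonnegSymmetricTraceLimit

/-!
# Six-vertex model: existence of the cylinder limit `M → ∞` of the balanced torus measures
# (DKLM 2026, Lemma 22 "Cylinder measure", via the transfer-matrix formalism of Part III §1)

H. Duminil-Copin, K. K. Kozlowski, P. Lammers, I. Manolescu, *Gaussian free field convergence of
the six-vertex model with `-1 ≤ Δ ≤ -1/2`*, arXiv:2603.06268 (2026) [DKLM2026SixVertexGFF]
(`paper:arxiv-2603.06268`, chunks p0018, p0040–p0041):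

> **Lemma 22** (Cylinder measure). Fix `c > 0`. The weak limit of `ℙ_{𝕋_{M,L}}[· | {balanced}]`
> as `M → ∞` exists and is denoted `ℙ_{CYL_L}`.
>
> **Corollary 56.** (2) *Composition rule.* `𝔬^{ii''}_{XY} = 𝔬^{i'i''}_Y ∘ 𝔬^{ii'}_X`.
> (3) *Torus measure.* `Z_{𝕋_{M,L}} ℙ_{𝕋_{M,L}}[{balanced}] 𝔼_{𝕋_{M,L}}[X | {balanced}] =
> Trace 𝔬^{0M}_X`. **Lemma 57.** The operator `t(π/2)` is a Hermitian Perron–Frobenius matrix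
> […] *Proof.* The operator `t(π/2)` is a real symmetric matrix in the basis `(e_κ)_κ`. […]
> (eq. (cylop)) `𝔼_{CYL_L}[X] = lim_{M→∞} ℙ_{𝕋_{M,L}}[X | {balanced}]
>   = lim_{M→∞} Trace(𝔬_X^{ii'} t(π/2)^{M-(i'-i)}) / Trace t(π/2)^M = v₀† 𝔒_X^{ii'} v₀.`
> […] *Proof of Lemma 22.* See Equation (cylop) above.

This file proves Lemma 22 for the objects of `Literature/Probability/LatticeModels/SixVertexGFF.lean`
in the form used by the predicate `IsPlanarSixVertexMeasure` (window events, torus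
`ZMod M × ZMod (2ℓ)`, isotropic weights `a = b = 1`, any `c > 0`), building on the transfer
matrix of `SixVertexTransferMatrix.lean`:

1. **Symmetry and positivity of the transfer matrix** (Lemma 55 (4) / Lemma 57, first part):
   `transferMatrix_transpose` (`(t_{a,b,c})ᵀ = t_{b,a,c}`), `balancedTransferMatrix_isSymm` /
   `_isHermitian` at `a = b`, `transferMatrix_nonneg`, `transferMatrix_diag_pos` (the column with
   all vertical arrows up has positive weight).
2. **Strip operators and the strip factorisation** (Cor. 56 (2)–(3) for indicator observables):
   `colMatrix`, `stripMatrix`, and `sum_strip_cyclic_eq_trace`: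
   `∑_{κ, α} 𝟙_D(strip) ∏_x w(κ_{x-1}, κ_x, α_x) = Trace (K_D · t^s)` on the torus with `r + s`
   columns, for any column weight `w` (path expansion + `Fin (r + s) ≃ Fin r ⊕ Fin s`).
3. **The window probabilities as trace ratios and their limit**:
   `sum_ite_isBalanced_strip_eq_trace`, `torusCondProbNat_eq_trace_div_trace`
   (`ℙ_{𝕋_{M,L}}[window_n ∈ S | balanced] = Trace(K t_𝔆^{s+1}) / Trace(t_𝔆^{(s+1)+(2n+1)})`,
   `M = 2n+1+(s+1)`, after moving the window to the corner by translation invariance), and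
   **`exists_tendsto_torusCondProbNat`**: for every `c > 0`, `ℓ`, `n`, `S`,
   `∃ q, ℙ_{𝕋_{M,2ℓ}}[window_n ∈ S | balanced] → q` as `M → ∞` (Lemma 22). Instead of the
   Perron–Frobenius "single block" property of Lemma 57, the limit uses that `t_𝔆` is symmetric,
   nonnegative, with positive diagonal, so that `-λ_max` is not an eigenvalue and the trace
   ratios converge without any non-degeneracy of the top eigenvalue
   (`Literature.LinearAlgebra.Matrix.tendsto_trace_mul_pow_div_trace_pow_add`).
4. **The cylinder window probabilities** `cylinderWindowProb c ℓ n S = ℙ_{CYL_{2ℓ}}[window_n ∈ S]`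
   (`limUnder`), `tendsto_cylinderWindowProb`, and the reduction
   `isPlanarSixVertexMeasure_iff_tendsto_cylinderWindowProb`: for `c > 0`, `P` is the planar
   slope-zero measure iff `ℙ_{CYL_{2ℓ}}[window_n ∈ S] → P[window_n ∈ S]` as `ℓ → ∞` (the inner
   limit of Theorem 2.2 is automatic).

## References

* H. Duminil-Copin, K. K. Kozlowski, P. Lammers, I. Manolescu, arXiv:2603.06268 (2026),
  Lemma 22, Part III §1 (Lemma 55, Cor. 56, Lemma 57, eq. (cylop)). [DKLM2026SixVertexGFF]
-/

noncomputable section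

open Finset Matrix Filter Topology
open Literature.LinearAlgebra.Matrix

namespace Literature.Probability.LatticeModels.SixVertex

/-! ## 1. Symmetry, non-negativity and positive diagonal of the transfer matrix -/

/-! ### The local weight under exchanging west/east and reversing the verticals -/

/-- Exchanging the west and east horizontal arrows and reversing both vertical arrows maps ice
configurations to ice configurations and exchanges the vertex types of weight `a` and `b`.
[cite: DKLM2026SixVertexGFF, Lemma 55 (4)] -/
theorem localWeight_swap (a b c : ℝ) (E W N S : Bool) :
    localWeight a b c E W N S = localWeight b a c W E (!N) (!S) := by
  cases E <;> cases W <;> cases N <;> cases S <;> simp [localWeight]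

/-- The local weights are non-negative for non-negative `a, b, c`. [folklore] -/
theorem localWeight_nonneg {a b c : ℝ} (ha : 0 ≤ a) (hb : 0 ≤ b) (hc : 0 ≤ c) (E W N S : Bool) :
    0 ≤ localWeight a b c E W N S := by
  unfold localWeight
  split_ifs <;> first | exact ha | exact hb | exact hc | exact le_rfl

/-- On a vertex whose west and east arrows agree and whose south and north arrows both point up,
the ice rule holds and the weight is `a` or `b`. [folklore] -/
theorem localWeight_self_true_true (a b c : ℝ) (E : Bool) :
    localWeight a b c E E true true = if E = true then a else b := by
  cases E <;> simp [localWeight]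

section Column

variable {G₂ : Type*} [AddGroup G₂] [One G₂] [Fintype G₂]

/-- Column weights under exchanging west/east and reversing the verticals.
[cite: DKLM2026SixVertexGFF, Lemma 55 (4)] -/
theorem columnWeight_swap (a b c : ℝ) (κ κ' α : G₂ → Bool) :
    columnWeight a b c κ κ' α = columnWeight b a c κ' κ (fun y => !α y) := by
  unfold columnWeight
  exact Finset.prod_congr rfl fun _ _ => localWeight_swap a b c _ _ _ _

/-- Column weights are non-negative for non-negative `a, b, c`. [folklore] -/
theorem columnWeight_nonneg {a b c : ℝ} (ha : 0 ≤ a) (hb : 0 ≤ b) (hc : 0 ≤ c)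
    (κ κ' α : G₂ → Bool) : 0 ≤ columnWeight a b c κ κ' α :=
  Finset.prod_nonneg fun _ _ => localWeight_nonneg ha hb hc _ _ _ _

/-- The column with equal west and east arrows `κ` and all vertical arrows up has weight
`∏_y (a if κ y else b)`. [folklore] -/
theorem columnWeight_self_const_true (a b c : ℝ) (κ : G₂ → Bool) :
    columnWeight a b c κ κ (fun _ => true) = ∏ y, (if κ y = true then a else b) := by
  unfold columnWeight
  exact Finset.prod_congr rfl fun y _ => localWeight_self_true_true a b c (κ y)

variable [DecidableEq G₂]

/-- **`(t_{a,b,c})ᵀ = t_{b,a,c}`**: transposing the transfer matrix exchanges `a` and `b`.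
[cite: DKLM2026SixVertexGFF, Lemma 55 (4)] -/
theorem transferMatrix_transpose (a b c : ℝ) :
    (transferMatrix (G₂ := G₂) a b c)ᵀ = transferMatrix b a c := by
  ext κ κ'
  simp only [transpose_apply, transferMatrix, of_apply]
  have hinv : Function.Involutive (fun (α : G₂ → Bool) (y : G₂) => !α y) := by
    intro α
    funext y
    simp
  rw [← Equiv.sum_comp (hinv.toPerm _)]
  refine Finset.sum_congr rfl fun α _ => ?_
  rw [Function.Involutive.coe_toPerm, columnWeight_swap]
  congr 1
  funext y
  simp

/-- **The transfer matrix is real symmetric when `a = b`** (Lemma 57: "`t(π/2)` is a real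
symmetric matrix in the basis `(e_κ)_κ`", isotropic weights `a = b = 1`).
[cite: DKLM2026SixVertexGFF, Lemma 57] -/
theorem transferMatrix_isSymm (a c : ℝ) : (transferMatrix (G₂ := G₂) a a c).IsSymm :=
  transferMatrix_transpose a a c

/-- The balanced transfer matrix `t_𝔆` is real symmetric when `a = b`. [cite: DKLM2026SixVertexGFF, Lemma 57] -/
theorem balancedTransferMatrix_isSymm (a c : ℝ) :
    (balancedTransferMatrix (G₂ := G₂) a a c).IsSymm := by
  unfold balancedTransferMatrix
  rw [Matrix.IsSymm, transpose_submatrix, (transferMatrix_isSymm a c).eq]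

/-- The balanced transfer matrix is Hermitian (over `ℝ`: symmetric) when `a = b`.
[cite: DKLM2026SixVertexGFF, Lemma 57] -/
theorem balancedTransferMatrix_isHermitian (a c : ℝ) :
    (balancedTransferMatrix (G₂ := G₂) a a c).IsHermitian := by
  rw [Matrix.IsHermitian, conjTranspose_eq_transpose_of_trivial]
  exact balancedTransferMatrix_isSymm a c

/-- Entries of the transfer matrix are non-negative for non-negative weights. [folklore] -/
theorem transferMatrix_nonneg {a b c : ℝ} (ha : 0 ≤ a) (hb : 0 ≤ b) (hc : 0 ≤ c)
    (κ κ' : G₂ → Bool) : 0 ≤ transferMatrix a b c κ κ' := by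
  simp only [transferMatrix, of_apply]
  exact Finset.sum_nonneg fun α _ => columnWeight_nonneg ha hb hc _ _ _

/-- Entries of the balanced transfer matrix are non-negative for non-negative weights. [folklore] -/
theorem balancedTransferMatrix_nonneg {a b c : ℝ} (ha : 0 ≤ a) (hb : 0 ≤ b) (hc : 0 ≤ c)
    (κ κ' : {κ : G₂ → Bool // IsBalancedCol κ}) : 0 ≤ balancedTransferMatrix a b c κ κ' :=
  transferMatrix_nonneg ha hb hc _ _

/-- **Every diagonal entry of the transfer matrix is positive** for `a, b > 0`, `c ≥ 0`: the
column with all vertical arrows up contributes `∏_y (a or b) > 0`. [cite: DKLM2026SixVertexGFF, Lemma 57] -/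
theorem transferMatrix_diag_pos {a b c : ℝ} (ha : 0 < a) (hb : 0 < b) (hc : 0 ≤ c)
    (κ : G₂ → Bool) : 0 < transferMatrix a b c κ κ := by
  simp only [transferMatrix, of_apply]
  have hterm : 0 < columnWeight a b c κ κ (fun _ => true) := by
    rw [columnWeight_self_const_true]
    exact Finset.prod_pos fun y _ => by split_ifs <;> assumption
  exact lt_of_lt_of_le hterm (Finset.single_le_sum (f := fun α => columnWeight a b c κ κ α)
    (fun α _ => columnWeight_nonneg ha.le hb.le hc _ _ _) (Finset.mem_univ fun _ => true))

/-- Every diagonal entry of the balanced transfer matrix is positive for `a, b > 0`, `c ≥ 0`.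
[cite: DKLM2026SixVertexGFF, Lemma 57] -/
theorem balancedTransferMatrix_diag_pos {a b c : ℝ} (ha : 0 < a) (hb : 0 < b) (hc : 0 ≤ c)
    (κ : {κ : G₂ → Bool // IsBalancedCol κ}) : 0 < balancedTransferMatrix a b c κ κ :=
  transferMatrix_diag_pos ha hb hc _

end Column

/-! ## 2. Strip operators and the strip factorisation on the torus -/

section Strip

variable {S V R : Type*} [Fintype S] [DecidableEq S] [Fintype V] [CommSemiring R]

/-- The one-column transfer matrix `t(i, j) = ∑_β w(i, j, β)` of a column weight `w` (west state
`i`, east state `j`, vertical arrows `β`). [cite: DKLM2026SixVertexGFF, Cor. 56 (1)] -/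
def colMatrix (w : S → S → V → R) : Matrix S S R :=
  Matrix.of fun i j => ∑ β : V, w i j β

/-- The **strip operator** of a strip event `D` on `r' + 1` consecutive columns:
`K_D(i, j) = ∑ 𝟙_D ∏_{k ≤ r'} w(u_k, u_{k+1}, α'_k)` over the strip configurations
`u = (i, κ'_0, …, κ'_{r'-1}, j)` of east column states and vertical arrows `α'`
(the operator `𝔬_{𝟙_D}^{0,r'+1}` of Cor. 56). [cite: DKLM2026SixVertexGFF, Cor. 56] -/
def stripMatrix (r' : ℕ) (w : S → S → V → R) (D : (Fin (r' + 1) → S) → (Fin (r' + 1) → V) → Prop)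
    [∀ κ α, Decidable (D κ α)] : Matrix S S R :=
  Matrix.of fun i j => ∑ κ' : Fin r' → S, ∑ α' : Fin (r' + 1) → V,
    if D (Fin.snoc κ' j) α' then
      ∏ k : Fin (r' + 1),
        w ((Fin.cons i (Fin.snoc κ' j : Fin (r' + 1) → S) : Fin (r' + 2) → S) k.castSucc)
          ((Fin.cons i (Fin.snoc κ' j : Fin (r' + 1) → S) : Fin (r' + 2) → S) k.succ) (α' k)
    else 0

/-- Entries of powers of a matrix as path sums. [folklore] -/
theorem pow_succ_apply_eq_sum_paths (m : ℕ) (T : Matrix S S R) (i j : S) :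
    (T ^ (m + 1)) i j = ∑ q : Fin m → S, ∏ k : Fin (m + 1),
      T ((Fin.cons i (Fin.snoc q j : Fin (m + 1) → S) : Fin (m + 2) → S) k.castSucc)
        ((Fin.cons i (Fin.snoc q j : Fin (m + 1) → S) : Fin (m + 2) → S) k.succ) := by
  have h := listProd_ofFn_apply_eq_sum_paths m (fun _ => T) i j
  rwa [List.ofFn_const, List.prod_replicate] at h

/-! #### Predecessors in `Fin (r + s)` of the glued column indices -/

omit [Fintype S] [DecidableEq S] [Fintype V] [CommSemiring R] in
/-- `castAdd 0 - 1 = natAdd last`. [folklore] -/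
theorem castAdd_zero_sub_one (r' s' : ℕ) :
    (Fin.castAdd (s' + 1) (0 : Fin (r' + 1)) : Fin (r' + 1 + (s' + 1))) - 1 =
      Fin.natAdd (r' + 1) (Fin.last s') := by
  ext
  rw [Fin.val_sub, Fin.val_one']
  have h1 : 1 % (r' + 1 + (s' + 1)) = 1 := Nat.mod_eq_of_lt (by omega)
  simp only [h1, Fin.val_castAdd, Fin.val_zero, add_zero, Fin.val_natAdd, Fin.val_last]
  rw [Nat.mod_eq_of_lt (by omega)]
  omega

omit [Fintype S] [DecidableEq S] [Fintype V] [CommSemiring R] in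
/-- `castAdd (k+1) - 1 = castAdd k`. [folklore] -/
theorem castAdd_succ_sub_one (r' s' : ℕ) (k : Fin r') :
    (Fin.castAdd (s' + 1) k.succ : Fin (r' + 1 + (s' + 1))) - 1 =
      Fin.castAdd (s' + 1) k.castSucc := by
  ext
  rw [Fin.val_sub, Fin.val_one']
  have h1 : 1 % (r' + 1 + (s' + 1)) = 1 := Nat.mod_eq_of_lt (by omega)
  simp only [h1, Fin.val_castAdd, Fin.val_succ, Fin.val_castSucc]
  have h2 : r' + 1 + (s' + 1) - 1 + (k + 1) = k + (r' + 1 + (s' + 1)) := by omega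
  rw [h2, Nat.add_mod_right, Nat.mod_eq_of_lt (by omega)]

omit [Fintype S] [DecidableEq S] [Fintype V] [CommSemiring R] in
/-- `natAdd 0 - 1 = castAdd last`. [folklore] -/
theorem natAdd_zero_sub_one (r' s' : ℕ) :
    (Fin.natAdd (r' + 1) (0 : Fin (s' + 1)) : Fin (r' + 1 + (s' + 1))) - 1 =
      Fin.castAdd (s' + 1) (Fin.last r') := by
  ext
  rw [Fin.val_sub, Fin.val_one']
  have h1 : 1 % (r' + 1 + (s' + 1)) = 1 := Nat.mod_eq_of_lt (by omega)
  simp only [h1, Fin.val_natAdd, Fin.val_zero, add_zero, Fin.val_castAdd, Fin.val_last]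
  have h2 : r' + 1 + (s' + 1) - 1 + (r' + 1) = r' + (r' + 1 + (s' + 1)) := by omega
  rw [h2, Nat.add_mod_right, Nat.mod_eq_of_lt (by omega)]

omit [Fintype S] [DecidableEq S] [Fintype V] [CommSemiring R] in
/-- `natAdd (k+1) - 1 = natAdd k`. [folklore] -/
theorem natAdd_succ_sub_one (r' s' : ℕ) (k : Fin s') :
    (Fin.natAdd (r' + 1) k.succ : Fin (r' + 1 + (s' + 1))) - 1 =
      Fin.natAdd (r' + 1) k.castSucc := by
  ext
  rw [Fin.val_sub, Fin.val_one']
  have h1 : 1 % (r' + 1 + (s' + 1)) = 1 := Nat.mod_eq_of_lt (by omega)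
  simp only [h1, Fin.val_natAdd, Fin.val_succ, Fin.val_castSucc]
  have h2 : r' + 1 + (s' + 1) - 1 + (r' + 1 + (k + 1)) = r' + 1 + k + (r' + 1 + (s' + 1)) := by
    omega
  rw [h2, Nat.add_mod_right, Nat.mod_eq_of_lt (by omega)]

/-! #### The cyclic product of column weights splits along the glued columns -/

omit [Fintype S] [DecidableEq S] [Fintype V] in
/-- On the torus of `r' + 1 + (s' + 1)` columns whose column states are the gluing of a strip
`(κ'_0, …, κ'_{r'-1}, j)` and a path `(q_0, …, q_{s'-1}, i)`, the cyclic product of column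
weights is (strip product from `i`) × (path product from `j` to `i`). [folklore] -/
theorem prod_cyclic_append (r' s' : ℕ) (w : S → S → V → R) (i j : S) (κ' : Fin r' → S)
    (q : Fin s' → S) (α₁ : Fin (r' + 1) → V) (α₂ : Fin (s' + 1) → V) :
    (∏ x : Fin (r' + 1 + (s' + 1)),
      w (Fin.append (Fin.snoc κ' j : Fin (r' + 1) → S) (Fin.snoc q i : Fin (s' + 1) → S) (x - 1))
        (Fin.append (Fin.snoc κ' j : Fin (r' + 1) → S) (Fin.snoc q i : Fin (s' + 1) → S) x)
        (Fin.append α₁ α₂ x)) =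
    (∏ k : Fin (r' + 1),
      w ((Fin.cons i (Fin.snoc κ' j : Fin (r' + 1) → S) : Fin (r' + 2) → S) k.castSucc)
        ((Fin.cons i (Fin.snoc κ' j : Fin (r' + 1) → S) : Fin (r' + 2) → S) k.succ) (α₁ k)) *
    ∏ k : Fin (s' + 1),
      w ((Fin.cons j (Fin.snoc q i : Fin (s' + 1) → S) : Fin (s' + 2) → S) k.castSucc)
        ((Fin.cons j (Fin.snoc q i : Fin (s' + 1) → S) : Fin (s' + 2) → S) k.succ) (α₂ k) := by
  rw [Fin.prod_univ_add]
  congr 1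
  · refine Finset.prod_congr rfl fun k _ => ?_
    rw [Fin.append_left, Fin.append_left]
    congr 1
    · induction k using Fin.cases with
      | zero =>
        rw [castAdd_zero_sub_one, Fin.append_right, Fin.snoc_last, Fin.castSucc_zero,
          Fin.cons_zero]
      | succ k =>
        rw [castAdd_succ_sub_one, Fin.append_left, Fin.snoc_castSucc, Fin.castSucc_succ,
          Fin.cons_succ, Fin.snoc_castSucc]
  · refine Finset.prod_congr rfl fun k _ => ?_
    rw [Fin.append_right, Fin.append_right]
    congr 1
    · induction k using Fin.cases with
      | zero =>
        rw [natAdd_zero_sub_one, Fin.append_left, Fin.snoc_last, Fin.castSucc_zero, Fin.cons_zero]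
      | succ k =>
        rw [natAdd_succ_sub_one, Fin.append_right, Fin.snoc_castSucc, Fin.castSucc_succ,
          Fin.cons_succ, Fin.snoc_castSucc]

/-- **Strip/cylinder factorisation on the torus** (Cor. 56 (2)–(3) for indicator observables):
on the torus with `r' + 1 + (s' + 1)` columns, the sum of `𝟙_D(strip) · ∏_x w(κ_{x-1}, κ_x, α_x)`
over all column states `κ` and vertical arrows `α`, where `D` only reads the first `r' + 1`
columns, equals `Trace (K_D · t^{s'+1})`. [cite: DKLM2026SixVertexGFF, Cor. 56 (2)–(3)] -/
theorem sum_strip_cyclic_eq_trace (r' s' : ℕ) (w : S → S → V → R)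
    (D : (Fin (r' + 1) → S) → (Fin (r' + 1) → V) → Prop) [∀ κ α, Decidable (D κ α)] :
    ∑ κ : Fin (r' + 1 + (s' + 1)) → S, ∑ α : Fin (r' + 1 + (s' + 1)) → V,
        (if D (fun k => κ (Fin.castAdd (s' + 1) k)) (fun k => α (Fin.castAdd (s' + 1) k)) then
          ∏ x : Fin (r' + 1 + (s' + 1)), w (κ (x - 1)) (κ x) (α x) else 0) =
      Matrix.trace (stripMatrix r' w D * colMatrix w ^ (s' + 1)) := by
  -- expand the right-hand side into a sixfold sum
  have hT : ∀ j i : S, (colMatrix w ^ (s' + 1)) j i = ∑ q : Fin s' → S, ∑ β : Fin (s' + 1) → V,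
      ∏ k : Fin (s' + 1),
        w ((Fin.cons j (Fin.snoc q i : Fin (s' + 1) → S) : Fin (s' + 2) → S) k.castSucc)
          ((Fin.cons j (Fin.snoc q i : Fin (s' + 1) → S) : Fin (s' + 2) → S) k.succ) (β k) := by
    intro j i
    rw [pow_succ_apply_eq_sum_paths]
    refine Finset.sum_congr rfl fun q _ => ?_
    simp only [colMatrix, Matrix.of_apply]
    rw [Finset.prod_univ_sum, Fintype.piFinset_univ]
  rw [Matrix.trace]
  simp only [Matrix.diag_apply, Matrix.mul_apply, hT, stripMatrix, Matrix.of_apply,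
    Finset.sum_mul_sum]
  -- reparametrise the left-hand side: `κ = append (snoc κ' j) (snoc q i)`, `α = append α₁ α₂`
  rw [← (Fin.appendEquiv (r' + 1) (s' + 1)).sum_comp, Fintype.sum_prod_type]
  simp only [Fin.appendEquiv_apply]
  have hα : ∀ κ₁ : Fin (r' + 1) → S, ∀ κ₂ : Fin (s' + 1) → S,
      (∑ α : Fin (r' + 1 + (s' + 1)) → V,
        (if D (fun k => Fin.append κ₁ κ₂ (Fin.castAdd (s' + 1) k))
            (fun k => α (Fin.castAdd (s' + 1) k)) then
          ∏ x, w (Fin.append κ₁ κ₂ (x - 1)) (Fin.append κ₁ κ₂ x) (α x) else 0)) =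
      ∑ α₁ : Fin (r' + 1) → V, ∑ α₂ : Fin (s' + 1) → V,
        (if D κ₁ α₁ then
          ∏ x, w (Fin.append κ₁ κ₂ (x - 1)) (Fin.append κ₁ κ₂ x) (Fin.append α₁ α₂ x) else 0) := by
    intro κ₁ κ₂
    rw [← (Fin.appendEquiv (r' + 1) (s' + 1)).sum_comp, Fintype.sum_prod_type]
    simp only [Fin.appendEquiv_apply, Fin.append_left]
  simp only [hα]
  rw [← (Fin.snocEquiv fun _ => S).sum_comp, Fintype.sum_prod_type]
  simp only [show ∀ (a : S) (b : Fin r' → S),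
    ((Fin.snocEquiv fun _ => S) (a, b) : Fin (r' + 1) → S) = Fin.snoc b a from fun _ _ => rfl]
  have hκ₂ : ∀ F : (Fin (s' + 1) → S) → R,
      ∑ κ₂ : Fin (s' + 1) → S, F κ₂ = ∑ i : S, ∑ q : Fin s' → S, F (Fin.snoc q i) := by
    intro F
    rw [← (Fin.snocEquiv fun _ => S).sum_comp, Fintype.sum_prod_type]
    rfl
  simp only [hκ₂]
  -- both sides are now sums over `j, κ', i, q, α₁, α₂` resp. `i, j, κ', q, α', β`; reorder
  conv_lhs =>
    arg 2
    ext j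
    rw [Finset.sum_comm]
  conv_lhs => rw [Finset.sum_comm]
  refine Finset.sum_congr rfl fun i _ => Finset.sum_congr rfl fun j _ =>
    Finset.sum_congr rfl fun κ' _ => Finset.sum_congr rfl fun q _ =>
    Finset.sum_congr rfl fun α₁ _ => Finset.sum_congr rfl fun α₂ _ => ?_
  -- termwise
  split_ifs with hD
  · rw [prod_cyclic_append]
  · rw [zero_mul]

end Strip

/-! ## 3. The cylinder limit of the window probabilities -/

section Numerator

variable {G₂ : Type*} [AddGroup G₂] [One G₂] [Fintype G₂] [DecidableEq G₂]

/-- The one-column transfer matrix of the balanced six-vertex column weights is the balanced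
transfer matrix `t_𝔆`. [cite: DKLM2026SixVertexGFF, Cor. 56 (1)] -/
theorem colMatrix_balanced (a b c : ℝ) :
    colMatrix (fun (i j : {κ : G₂ → Bool // IsBalancedCol κ}) (β : G₂ → Bool) =>
        columnWeight a b c i.1 j.1 β) = balancedTransferMatrix a b c := by
  ext i j
  rfl

/-- Natural-number casts of strip column indices are the glued-in `Fin.castAdd` indices.
[folklore] -/
theorem natCast_zmod_eq_castAdd (r' s' : ℕ) (k : Fin (r' + 1)) :
    ((k : ℕ) : ZMod (r' + 1 + (s' + 1))) = Fin.castAdd (s' + 1) k := by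
  have hk := k.2
  apply Fin.ext
  show ZMod.val ((k : ℕ) : ZMod (r' + 1 + (s' + 1))) = (Fin.castAdd (s' + 1) k).val
  rw [ZMod.val_natCast, Fin.val_castAdd, Nat.mod_eq_of_lt (by omega)]

open scoped Classical in
/-- **The numerator as a trace** (Cor. 56 (3) for the indicator of a strip event): on the torus
`ZMod (r'+1+(s'+1)) × G₂`, for an event `E` that only reads the columns `0, …, r'`,
`∑_{ω balanced, ω ∈ E} W(ω) = Trace (K_E · t_𝔆^{s'+1})`. [cite: DKLM2026SixVertexGFF, Cor. 56 (3)] -/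
theorem sum_ite_isBalanced_strip_eq_trace (a b c : ℝ) (r' s' : ℕ)
    (D : (Fin (r' + 1) → G₂ → Bool) → (Fin (r' + 1) → G₂ → Bool) → Prop)
    [∀ κ α, Decidable (D κ α)] (E : Set (Config (ZMod (r' + 1 + (s' + 1)) × G₂)))
    (hE : ∀ ω, ω ∈ E ↔ D (fun k y => (ω (Fin.castAdd (s' + 1) k, y)).1)
      (fun k y => (ω (Fin.castAdd (s' + 1) k, y)).2)) :
    (∑ ω : Config (ZMod (r' + 1 + (s' + 1)) × G₂),
        if IsBalanced ω ∧ ω ∈ E then torusWeight a b c ω else 0) =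
      Matrix.trace (stripMatrix r'
          (fun (i j : {κ : G₂ → Bool // IsBalancedCol κ}) (β : G₂ → Bool) =>
            columnWeight a b c i.1 j.1 β)
          (fun κ₁ α₁ => D (fun k => (κ₁ k).1) α₁) *
        balancedTransferMatrix a b c ^ (s' + 1)) := by
  -- Step 1: split configurations into columns of horizontal and vertical arrows
  rw [← (columnSplit (ZMod (r' + 1 + (s' + 1))) G₂).symm.sum_comp, Fintype.sum_prod_type]
  have h1 : ∀ κ : ZMod (r' + 1 + (s' + 1)) → G₂ → Bool,
      (∑ α : ZMod (r' + 1 + (s' + 1)) → G₂ → Bool,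
        if IsBalanced ((columnSplit (ZMod (r' + 1 + (s' + 1))) G₂).symm (κ, α)) ∧
            (columnSplit (ZMod (r' + 1 + (s' + 1))) G₂).symm (κ, α) ∈ E then
          torusWeight a b c ((columnSplit (ZMod (r' + 1 + (s' + 1))) G₂).symm (κ, α)) else 0) =
      if ∀ x, IsBalancedCol (κ x) then
        ∑ α : ZMod (r' + 1 + (s' + 1)) → G₂ → Bool,
          (if D (fun k => κ (Fin.castAdd (s' + 1) k)) (fun k => α (Fin.castAdd (s' + 1) k)) then
            ∏ x, columnWeight a b c (κ (x - 1)) (κ x) (α x) else 0)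
      else 0 := by
    intro κ
    have hbal : ∀ α : ZMod (r' + 1 + (s' + 1)) → G₂ → Bool,
        IsBalanced ((columnSplit (ZMod (r' + 1 + (s' + 1))) G₂).symm (κ, α)) ↔
          ∀ x, IsBalancedCol (κ x) := fun α => Iff.rfl
    have hmem : ∀ α : ZMod (r' + 1 + (s' + 1)) → G₂ → Bool,
        (columnSplit (ZMod (r' + 1 + (s' + 1))) G₂).symm (κ, α) ∈ E ↔
          D (fun k => κ (Fin.castAdd (s' + 1) k)) (fun k => α (Fin.castAdd (s' + 1) k)) :=
      fun α => hE _
    have hW : ∀ α : ZMod (r' + 1 + (s' + 1)) → G₂ → Bool,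
        torusWeight a b c ((columnSplit (ZMod (r' + 1 + (s' + 1))) G₂).symm (κ, α)) =
          ∏ x, columnWeight a b c (κ (x - 1)) (κ x) (α x) :=
      fun α => torusWeight_eq_prod_columnWeight a b c _
    by_cases hb : ∀ x, IsBalancedCol (κ x)
    · rw [if_pos hb]
      refine Finset.sum_congr rfl fun α _ => ?_
      by_cases hd : D (fun k => κ (Fin.castAdd (s' + 1) k)) (fun k => α (Fin.castAdd (s' + 1) k))
      · rw [if_pos ⟨(hbal α).2 hb, (hmem α).2 hd⟩, if_pos hd, hW]
      · rw [if_neg (fun h => hd ((hmem α).1 h.2)), if_neg hd]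
    · rw [if_neg hb]
      refine Finset.sum_eq_zero fun α _ => ?_
      rw [if_neg (fun h => hb ((hbal α).1 h.1))]
  simp only [h1]
  -- Step 2: restrict to everywhere-balanced `κ`, i.e. to `κ : ZMod _ → 𝔆`
  rw [← Finset.sum_filter,
    Finset.sum_subtype
      (Finset.univ.filter fun κ : ZMod (r' + 1 + (s' + 1)) → G₂ → Bool => ∀ x, IsBalancedCol (κ x))
      (p := fun κ : ZMod (r' + 1 + (s' + 1)) → G₂ → Bool => ∀ x, IsBalancedCol (κ x)) (by simp),
    ← (Equiv.subtypePiEquivPi (β := fun _ : ZMod (r' + 1 + (s' + 1)) => G₂ → Bool)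
      (p := fun _ κ => IsBalancedCol κ)).symm.sum_comp]
  -- Step 3: the strip factorisation
  rw [← colMatrix_balanced a b c, ← sum_strip_cyclic_eq_trace r' s']
  refine Finset.sum_congr rfl fun p _ => Finset.sum_congr rfl fun α _ => ?_
  rfl

end Numerator

/-! ### The window conditional probabilities as trace ratios -/

section Window

/-- A balanced column exists on `ZMod (2(ℓ+1))`: the first half of the arrows point east.
[folklore] -/
theorem isBalancedCol_val_lt (ℓ : ℕ) :
    IsBalancedCol (G₂ := ZMod (2 * (ℓ + 1))) fun y => decide (ZMod.val y < ℓ + 1) := by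
  unfold IsBalancedCol
  have hcard : (Finset.univ.filter fun y : ZMod (2 * (ℓ + 1)) =>
      decide (ZMod.val y < ℓ + 1) = true).card = (Finset.range (ℓ + 1)).card := by
    refine Finset.card_bij (fun y _ => ZMod.val y) (fun y hy => ?_) (fun y₁ _ y₂ _ h => ?_)
      (fun m hm => ?_)
    · simpa using hy
    · exact ZMod.val_injective _ h
    · refine ⟨(m : ZMod (2 * (ℓ + 1))), ?_, ?_⟩
      · rw [Finset.mem_range] at hm
        simp only [Finset.mem_filter, Finset.mem_univ, true_and, decide_eq_true_eq,
          ZMod.val_natCast]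
        exact (Nat.mod_le _ _).trans_lt hm
      · rw [Finset.mem_range] at hm
        rw [ZMod.val_natCast, Nat.mod_eq_of_lt (by omega)]
  rw [Finset.card_range] at hcard
  rw [hcard, ZMod.card]

/-- The balanced column configurations of `ZMod (2(ℓ+1))` form a nonempty type. [folklore] -/
instance nonempty_balancedCol (ℓ : ℕ) :
    Nonempty {κ : ZMod (2 * (ℓ + 1)) → Bool // IsBalancedCol κ} :=
  ⟨⟨_, isBalancedCol_val_lt ℓ⟩⟩

/-- The strip event of a window pattern set `S` read on the columns `0, …, 2n` of the torus
(column states `κ₁`, vertical arrows `α₁`), as a predicate. [folklore] -/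
def windowStripEvent (L n : ℕ) (S : Set (Config (Fin (2 * n + 1) × Fin (2 * n + 1))))
    (κ₁ α₁ : Fin (2 * n + 1) → ZMod L → Bool) : Prop :=
  (fun p : Fin (2 * n + 1) × Fin (2 * n + 1) =>
    (κ₁ p.1 ((p.2 : ℕ) : ZMod L), α₁ p.1 ((p.2 : ℕ) : ZMod L))) ∈ S

/-- The window strip event is decidable (membership of a finite pattern in a set, classically).
[folklore] -/
instance windowStripEvent.decidable (L n : ℕ) (S : Set (Config (Fin (2 * n + 1) × Fin (2 * n + 1))))
    (κ₁ α₁ : Fin (2 * n + 1) → ZMod L → Bool) : Decidable (windowStripEvent L n S κ₁ α₁) :=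
  Classical.propDecidable _

/-- The strip operator of the window event (the operator `𝔬_{𝟙_{window ∈ S}}` on `ℓ²(𝔆)`).
[cite: DKLM2026SixVertexGFF, Cor. 56] -/
def windowStripMatrix (c : ℝ) (L : ℕ) [NeZero L] (n : ℕ)
    (S : Set (Config (Fin (2 * n + 1) × Fin (2 * n + 1)))) :
    Matrix {κ : ZMod L → Bool // IsBalancedCol κ} {κ : ZMod L → Bool // IsBalancedCol κ} ℝ :=
  stripMatrix (2 * n)
    (fun (i j : {κ : ZMod L → Bool // IsBalancedCol κ}) (β : ZMod L → Bool) =>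
      columnWeight 1 1 c i.1 j.1 β)
    (fun κ₁ α₁ => windowStripEvent L n S (fun k => (κ₁ k).1) α₁)

/-- Moving the window to the columns and rows `0, …, 2n`: the torus window event is the
translate of the "pattern at the origin corner" event. [folklore] -/
theorem setOf_torusWindow_eq_shift (M L n : ℕ) (S : Set (Config (Fin (2 * n + 1) × Fin (2 * n + 1)))) :
    {ω : Config (ZMod M × ZMod L) | torusWindow n ω ∈ S} =
      {ω | (fun w => ω (w + (-((n : ℕ) : ZMod M), -((n : ℕ) : ZMod L)))) ∈
        {ω : Config (ZMod M × ZMod L) |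
          (fun p : Fin (2 * n + 1) × Fin (2 * n + 1) =>
            ω (((p.1 : ℕ) : ZMod M), ((p.2 : ℕ) : ZMod L))) ∈ S}} := by
  ext ω
  simp only [Set.mem_setOf_eq]
  suffices h : torusWindow n ω = fun p : Fin (2 * n + 1) × Fin (2 * n + 1) =>
      ω ((((p.1 : ℕ) : ZMod M), ((p.2 : ℕ) : ZMod L)) + (-((n : ℕ) : ZMod M), -((n : ℕ) : ZMod L))) by
    rw [h]
  funext p
  simp only [torusWindow, Prod.mk_add_mk]
  congr 2 <;> push_cast <;> ring

/-- **The window conditional probability as a ratio of traces** (eq. (cylop) before the limit):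
for `M = 2n + 1 + (s + 1)` columns,
`ℙ_{𝕋_{M,L}}[window_n ∈ S | balanced] = Trace(K_S t_𝔆^{s+1}) / Trace(t_𝔆^{(s+1)+(2n+1)})`.
[cite: DKLM2026SixVertexGFF, Part III §1, eq. (cylop)] -/
theorem torusCondProbNat_eq_trace_div_trace (c : ℝ) (L : ℕ) [NeZero L] (n s : ℕ)
    (S : Set (Config (Fin (2 * n + 1) × Fin (2 * n + 1)))) :
    torusCondProbNat 1 1 c (2 * n + 1 + (s + 1)) L n S =
      Matrix.trace (windowStripMatrix c L n S *
          balancedTransferMatrix (G₂ := ZMod L) 1 1 c ^ (s + 1)) /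
        Matrix.trace (balancedTransferMatrix (G₂ := ZMod L) 1 1 c ^ (s + 1 + (2 * n + 1))) := by
  classical
  unfold torusCondProbNat
  rw [dif_neg (by omega), dif_neg (NeZero.ne L), setOf_torusWindow_eq_shift,
    torusCondProb_shift_preimage]
  unfold torusCondProb
  simp only [Finset.sum_filter]
  congr 1
  · rw [sum_ite_isBalanced_strip_eq_trace 1 1 c (2 * n) s
      (fun κ₁ α₁ => windowStripEvent L n S κ₁ α₁)]
    · rfl
    · intro ω
      simp only [Set.mem_setOf_eq, windowStripEvent, natCast_zmod_eq_castAdd, Prod.mk.eta]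
  · have hden : (∑ ω ∈ Finset.univ.filter
        (fun ω : Config (ZMod (2 * n + 1 + (s + 1)) × ZMod L) => IsBalanced ω),
          torusWeight 1 1 c ω) =
        Matrix.trace (balancedTransferMatrix (G₂ := ZMod L) 1 1 c ^ (2 * n + 1 + (s + 1))) :=
      sum_torusWeight_filter_isBalanced_eq_trace 1 1 c (2 * n + 1 + s)
    rw [Finset.sum_filter] at hden
    rw [hden, Nat.add_comm (2 * n + 1) (s + 1)]

/-- **Lemma 22 (Cylinder measure), window form.** For the isotropic six-vertex model with
`a = b = 1` and any `c > 0`, every even circumference `2ℓ`, every window size `n` and every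
set `S` of window patterns, the conditional probabilities `ℙ_{𝕋_{M,2ℓ}}[window_n ∈ S | balanced]`
converge as `M → ∞`. [cite: DKLM2026SixVertexGFF, Lemma 22] -/
theorem exists_tendsto_torusCondProbNat (c : ℝ) (hc : 0 < c) (ℓ n : ℕ)
    (S : Set (Config (Fin (2 * n + 1) × Fin (2 * n + 1)))) :
    ∃ q : ℝ, Tendsto (fun M : ℕ => torusCondProbNat 1 1 c M (2 * ℓ) n S) atTop (𝓝 q) := by
  rcases Nat.eq_zero_or_pos ℓ with rfl | hℓ
  · refine ⟨0, tendsto_const_nhds.congr fun M => ?_⟩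
    unfold torusCondProbNat
    split_ifs with hM hL
    · rfl
    · rfl
    · exact absurd rfl hL
  obtain ⟨ℓ', rfl⟩ : ∃ ℓ', ℓ = ℓ' + 1 := ⟨ℓ - 1, by omega⟩
  set t : Matrix {κ : ZMod (2 * (ℓ' + 1)) → Bool // IsBalancedCol κ}
      {κ : ZMod (2 * (ℓ' + 1)) → Bool // IsBalancedCol κ} ℝ :=
    balancedTransferMatrix (G₂ := ZMod (2 * (ℓ' + 1))) 1 1 c with ht
  set K := windowStripMatrix c (2 * (ℓ' + 1)) n S with hK
  have hA : t.IsHermitian := balancedTransferMatrix_isHermitian 1 c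
  have hA0 : ∀ i j, i ≠ j → 0 ≤ t i j := fun i j _ =>
    balancedTransferMatrix_nonneg zero_le_one zero_le_one hc.le i j
  set δ : ℝ := Finset.univ.inf' Finset.univ_nonempty (fun i => t i i) with hδ
  have hδpos : 0 < δ := by
    obtain ⟨i₀, -, h⟩ := Finset.exists_mem_eq_inf' Finset.univ_nonempty (fun i => t i i)
    rw [hδ, h]
    exact balancedTransferMatrix_diag_pos zero_lt_one zero_lt_one hc.le i₀
  have hdiag : ∀ i, δ ≤ t i i := fun i => Finset.inf'_le _ (Finset.mem_univ i)
  have hlim := (tendsto_trace_mul_pow_div_trace_pow_add hA hA0 hδpos hdiag K (2 * n + 1)).comp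
    (tendsto_add_atTop_nat 1)
  refine ⟨_, (tendsto_add_atTop_iff_nat (2 * n + 2)).1 (hlim.congr fun s => ?_)⟩
  rw [Function.comp_apply, show s + (2 * n + 2) = 2 * n + 1 + (s + 1) by omega,
    torusCondProbNat_eq_trace_div_trace c (2 * (ℓ' + 1)) n s S]

/-! ### The cylinder window probabilities `ℙ_{CYL_{2ℓ}}[window_n ∈ S]` (Lemma 22) -/

/-- **The cylinder window probabilities** `ℙ_{CYL_{2ℓ}}[window_n ∈ S] :=
lim_{M → ∞} ℙ_{𝕋_{M,2ℓ}}[window_n ∈ S | balanced]` — the measure `ℙ_{CYL_L}` of Lemma 22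
evaluated on window events, for `a = b = 1` (meaningful for `c > 0`, where the limit exists by
`exists_tendsto_torusCondProbNat`; Mathlib's `limUnder`). [cite: DKLM2026SixVertexGFF, Lemma 22] -/
def cylinderWindowProb (c : ℝ) (ℓ n : ℕ) (S : Set (Config (Fin (2 * n + 1) × Fin (2 * n + 1)))) : ℝ :=
  limUnder atTop fun M : ℕ => torusCondProbNat 1 1 c M (2 * ℓ) n S

/-- `ℙ_{𝕋_{M,2ℓ}}[window_n ∈ S | balanced] → ℙ_{CYL_{2ℓ}}[window_n ∈ S]` as `M → ∞` (Lemma 22).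
[cite: DKLM2026SixVertexGFF, Lemma 22] -/
theorem tendsto_cylinderWindowProb (c : ℝ) (hc : 0 < c) (ℓ n : ℕ)
    (S : Set (Config (Fin (2 * n + 1) × Fin (2 * n + 1)))) :
    Tendsto (fun M : ℕ => torusCondProbNat 1 1 c M (2 * ℓ) n S) atTop
      (𝓝 (cylinderWindowProb c ℓ n S)) := by
  obtain ⟨q, hq⟩ := exists_tendsto_torusCondProbNat c hc ℓ n S
  exact tendsto_nhds_limUnder ⟨q, hq⟩

/-- **Theorem 2.2 reduced to the cylinder measures.** For `a = b = 1`, `c > 0`, a probability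
measure `P` is the planar slope-zero six-vertex measure (`IsPlanarSixVertexMeasure`, i.e. the
iterated limit `lim_ℓ lim_M ℙ_{𝕋_{M,2ℓ}}[· | balanced]` on window events) iff the cylinder window
probabilities `ℙ_{CYL_{2ℓ}}[window_n ∈ S]` converge to `P[window_n ∈ S]` as `ℓ → ∞`: the inner
limit `M → ∞` always exists by Lemma 22. [cite: DKLM2026SixVertexGFF, Thm. 2.2 and Lemma 22] -/
theorem isPlanarSixVertexMeasure_iff_tendsto_cylinderWindowProb (c : ℝ) (hc : 0 < c)
    (P : MeasureTheory.Measure (Config (ℤ × ℤ))) :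
    IsPlanarSixVertexMeasure 1 1 c P ↔ MeasureTheory.IsProbabilityMeasure P ∧
      ∀ (n : ℕ) (S : Set (Config (Fin (2 * n + 1) × Fin (2 * n + 1)))),
        Tendsto (fun ℓ => cylinderWindowProb c ℓ n S) atTop
          (𝓝 (P {ω | planeWindow n ω ∈ S}).toReal) := by
  refine and_congr_right fun _ => forall_congr' fun n => forall_congr' fun S => ?_
  constructor
  · rintro ⟨q, hq, hqP⟩
    have hq' : q = fun ℓ => cylinderWindowProb c ℓ n S :=
      funext fun ℓ => tendsto_nhds_unique (hq ℓ) (tendsto_cylinderWindowProb c hc ℓ n S)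
    rwa [hq'] at hqP
  · intro h
    exact ⟨_, fun ℓ => tendsto_cylinderWindowProb c hc ℓ n S, h⟩

end Window

end Literature.Probability.LatticeModels.SixVertex

end
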